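import Mathlib.Data.List.Chain
import Mathlib.Data.List.Nodup
import Mathlib.Data.Fintype.Card
import Mathlib.Data.Finset.Card
import Summits.Ventures.HSemireg.OneSidedWordNodup
import HarnessLib

/-!
# Venture HSemireg — the per-type visit budget of a loop word in a one-sided complex

Order/counting bookkeeping behind the MULTIPLICITY RULES of the UNIT-SPREAD deciders of the
computation cell `pub-hsemireg` (W1: `wdecide` v6's transit/self-arc rules, `usB` v1.2's switches
W1/W2, `usB13`'s full budget; `widen/W1/w1cx2/us12/README.md` §1). A one-sided twisted complex has
summands (copies) carrying a LETTER TYPE; a type of multiplicity `m` has exactly `m` copies. By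
`OneSidedWordNodup.nodup_word` the copies met by a loop word `x :: (out ++ inn)` are pairwise
distinct. The consequence used by the deciders is the TYPE-LEVEL BUDGET: along the word a letter
type `b` is met at most `mult b` times, and the base type `type x` at most `mult (type x) - 1`
times among the INTERIOR copies `out ++ inn` — so a copy-blind search may bound the visits of each
type by its multiplicity and forbid transit through the base type when its multiplicity is one.
Here the multiplicity `mult b` of a type `b` is written out as `(Finset.univ.filter fun a => type a = b).card`
(no new definition is introduced).

* `count_map_le_card_fiber` — for a duplicate-free list of copies, the number of entries of type
  `b` is at most the number of copies of type `b`;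
* `count_type_le_mult` — the budget for every type along a loop word;
* `count_base_type_interior_le` — the sharper budget `mult - 1` for the base type on the interior;
* `no_interior_base_type_of_mult_one` — multiplicity one ⇒ the base type is never met in the interior
  (the «no transit through a single-copy letter» rule W2).

HONEST FRAMING. Counting on finite lists only; the Lean index of the soundness of one bookkeeping
rule of a NECESSARY-condition sieve (model-level, conditional on the cell's PROPOSITION UNIT-SPREAD,
which is NOT formalised here). No sheaf, complex, abelian variety or semiregularity map appears;
nothing here says that HC, HC_CM or HC_AV holds, and nothing here is a new case of anything.
-/

namespace Summit.Ventures.HSemireg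

namespace OneSidedTypeBudget

open OneSidedWordNodup

variable {α β : Type*} [DecidableEq α] [DecidableEq β] [Fintype α]

/-- For a duplicate-free list of copies, the number of entries of type `b` is at most the number
of copies of type `b`. -/
theorem count_map_le_card_fiber (type : α → β) {l : List α} (hl : l.Nodup) (b : β) :
    (l.map type).count b ≤ (Finset.univ.filter fun a => type a = b).card := by
  classical
  rw [List.count_eq_length_filter, List.filter_map, List.length_map,
    ← List.toFinset_card_of_nodup (hl.filter _)]
  apply Finset.card_le_card
  intro a ha
  rw [List.mem_toFinset, List.mem_filter] at ha
  rw [Finset.mem_filter]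
  refine ⟨Finset.mem_univ a, ?_⟩
  simpa using ha.2

variable [Preorder α]

/-- **Type budget along a loop word.** For an out-path `x :: out` and an in-path `inn ++ [x]`,
both strictly increasing (one-sidedness), every letter type `b` is met at most `mult b` times
along the whole word `x :: (out ++ inn)`. -/
theorem count_type_le_mult (type : α → β) {x : α} {out inn : List α}
    (hout : List.IsChain (· < ·) (x :: out)) (hin : List.IsChain (· < ·) (inn ++ [x])) (b : β) :
    ((x :: (out ++ inn)).map type).count b ≤ (Finset.univ.filter fun a => type a = b).card :=
  count_map_le_card_fiber type (nodup_word hout hin) b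

/-- **The base type's interior budget.** Along the interior `out ++ inn` of the word, the base
copy's own type is met at most `mult (type x) - 1` times. -/
theorem count_base_type_interior_le (type : α → β) {x : α} {out inn : List α}
    (hout : List.IsChain (· < ·) (x :: out)) (hin : List.IsChain (· < ·) (inn ++ [x])) :
    ((out ++ inn).map type).count (type x)
      ≤ (Finset.univ.filter fun a => type a = type x).card - 1 := by
  have h := count_type_le_mult type hout hin (type x)
  have hcons : ((x :: (out ++ inn)).map type).count (type x)
      = ((out ++ inn).map type).count (type x) + 1 := by
    simp
  omega

/-- **No transit through a single-copy letter (rule W2).** If the base copy's type has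
multiplicity one, no interior copy of the word carries that type. -/
theorem no_interior_base_type_of_mult_one (type : α → β) {x : α} {out inn : List α}
    (hout : List.IsChain (· < ·) (x :: out)) (hin : List.IsChain (· < ·) (inn ++ [x]))
    (h1 : (Finset.univ.filter fun a => type a = type x).card = 1) :
    ∀ a ∈ out ++ inn, type a ≠ type x := by
  intro a ha hEq
  have hle := count_base_type_interior_le type hout hin
  rw [h1] at hle
  have hpos : 0 < ((out ++ inn).map type).count (type x) :=
    List.count_pos_iff.mpr (List.mem_map.mpr ⟨a, ha, hEq⟩)
  omega

end OneSidedTypeBudget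

end Summit.Ventures.HSemireg
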